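import Summits.HodgeConjecture.HodgeConjecture.Theorems.SignSymmetricPowersNodalFormPlane
import Summits.HodgeConjecture.HodgeConjecture.Theorems.SignSymmetricPowersNodalFormLine
import Summits.HodgeConjecture.HodgeConjecture.Theorems.SignSymmetricPowersNodalFormPair

/-!
# K1-B stub NODAL (route `SignSymmetricPowers`, item stmt-HodgeConjecture-19716) — ι-even nodal forms

Discharges the registered stub `stub_signNodalForms` (K1-B line `andre-zariski`, skeletons v9
`7018fd20b5a2f68f` / v10 `0556d3eecfc390fa`, WANTED P3-W8) of the crux `VeryGeneralSignCommutatorsInHg`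
(rank 2) of `route-HodgeConjecture-SignSymmetricPowers`; landed `--supports stmt-HodgeConjecture-19716` (it
does not close the item: the GEO stub and the fact binders remain). Sorry-free; axioms `propext`,
`Classical.choice`, `Quot.sound`; no named fact.

## Statement

`stub_signNodalForms` — the registered signature VERBATIM: for every even `d ≥ 4` there are ι-even
(`coeff e f = 0` whenever `e₀ + e₁` is odd; `ι = diag(−1,−1,1,1,1)`) quinary forms `f` of degree `d` with
`IsNodalFormWithNodes f ![p…]` (`Literature/AlgebraicGeometry/HodgeTheory/PicardLefschetzNodalForms`: each
listed `pᵢ` an ordinary double point, the `pᵢ` pairwise non-proportional, every singular point one of them)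
for the three node configurations of the K1-B discriminant components: (Π) `![e₄]`,
`e₄ = (0,0,0,0,1) ∈ Π = {x₀ = x₁ = 0}`; (L) `![e₀]`, `e₀ = (1,0,0,0,0) ∈ L = {x₂ = x₃ = x₄ = 0}`; (pair)
`![p₊, p₋]`, `p± = (±1,0,1,0,0)` (exchanged by `ι`). It is the concrete polynomial input of the
Picard–Lefschetz fact `picardLefschetz_nodalForms_uniform` in the GEO stub `stub_signPencilOrbitData`.

## Proof

With `d = m + 4`, `m` even (`m = 2n` for the pair), the three witnesses of
`SignSymmetricPowersNodalFormPlane` (`x₄^{m+2}(x₀x₁ + x₂x₃) + x₀^d + x₁^d + x₂^d + 2x₃^d`),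
`SignSymmetricPowersNodalFormLine` (`x₀^{m+2}((x₁+x₄)(x₁−x₄) + x₂x₃) + (x₁+x₄)^d + (x₁−x₄)^d + x₂^d + 2x₃^d`)
and `SignSymmetricPowersNodalFormPair{Hessian,}`
(`(x₀²−x₂²)²(x₀^{2n}+x₂^{2n}) + x₂^{2n+2}(x₁²+x₃x₄) + c₁x₁^d + x₃^d + c₄x₄^d`). The first two are SPLIT
variants of the blueprint `memos/K1B-NODAL-FORMS-g22.md` whose singular locus is determined by pure algebra
(`SignSymmetricPowersNodalFormsTools.split_pair_eq_zero`); the pair uses the blueprint's estimate (the base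
critical equation bounds `|x₀| ≤ 2|x₂|`, the transversal coefficients make `|x₁² + x₃x₄|` too large).
-/

-- `Summit.HodgeConjecture.HodgeConjecture.Theorems` is the mandated namespace (single-problem summit), which
-- `linter.dupNamespace` flags; the lakefile turns the linter off tree-wide, restated here for stand-alone checks.
set_option linter.dupNamespace false

noncomputable section

namespace Summit.HodgeConjecture.HodgeConjecture.Theorems.SignSymmetricPowersNodalForms

open MvPolynomial Literature.AlgebraicGeometry.Motives Literature.AlgebraicGeometry.HodgeTheory
open Summit.HodgeConjecture.HodgeConjecture.Theorems.SignSymmetricPowersNodalFormPlane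
open Summit.HodgeConjecture.HodgeConjecture.Theorems.SignSymmetricPowersNodalFormLine
open Summit.HodgeConjecture.HodgeConjecture.Theorems.SignSymmetricPowersNodalFormPair

/-- **K1-B stub NODAL** (`SignNodalForms`, registered signature verbatim, skeleton v9/v10 of
stmt-HodgeConjecture-19716): for every even `d ≥ 4`, ι-even quinary forms of degree `d` that are nodal with
exactly the nodes `e₄ ∈ Π`, resp. `e₀ ∈ L`, resp. the ι-exchanged pair `p± = (±1,0,1,0,0)`. Proof: the three
explicit witnesses at `d = m + 4`. -/
theorem stub_signNodalForms :
    ∀ ⦃d : ℕ⦄, Even d → 4 ≤ d → (∃ f : MvPolynomial (Fin 5) ℂ, f.IsHomogeneous d ∧ (∀ e : Fin 5 →₀ ℕ, ¬ Even (e 0 + e 1) → f.coeff e = 0) ∧ Literature.AlgebraicGeometry.HodgeTheory.IsNodalFormWithNodes f ![(![0, 0, 0, 0, 1] : Fin 5 → ℂ)]) ∧ (∃ f : MvPolynomial (Fin 5) ℂ, f.IsHomogeneous d ∧ (∀ e : Fin 5 →₀ ℕ, ¬ Even (e 0 + e 1) → f.coeff e = 0) ∧ Literature.AlgebraicGeometry.HodgeTheory.IsNodalFormWithNodes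 f ![(![1, 0, 0, 0, 0] : Fin 5 → ℂ)]) ∧ (∃ f : MvPolynomial (Fin 5) ℂ, f.IsHomogeneous d ∧ (∀ e : Fin 5 →₀ ℕ, ¬ Even (e 0 + e 1) → f.coeff e = 0) ∧ Literature.AlgebraicGeometry.HodgeTheory.IsNodalFormWithNodes f ![(![1, 0, 1, 0, 0] : Fin 5 → ℂ), ![-1, 0, 1, 0, 0]]) := by
  intro d hd h4
  obtain ⟨m, rfl⟩ := Nat.exists_eq_add_of_le' h4
  have hm : Even m := by
    have h4e : Even 4 := ⟨2, rfl⟩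
    exact (Nat.even_add.1 hd).2 h4e
  refine ⟨exists_planeNodalForm m hm, exists_lineNodalForm m hm, ?_⟩
  obtain ⟨n, rfl⟩ := hm
  rw [show n + n + 4 = 2 * n + 4 by ring]
  exact exists_pairNodalForm n

end Summit.HodgeConjecture.HodgeConjecture.Theorems.SignSymmetricPowersNodalForms

end
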